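/-
Copyright (c) 2026 the pub-hodgecm-mathlib formalisation cell (harness21).  Prover seat hodgecm-mathlib-K2E3-p17 (g10), HCML Track B «K2-LIT» ∕ h413
(`stmt-HodgeConjecture-24833`), R90-TF section S3 hand (U3) «CFT residual pair», brick (T1) χ-pre of the census `R90/S3/CENSUS-U3-globalise.K2E3-p17-g10.md`
(R90-C12-plan (g2) DEAL 2026-09-04T23:34:52Z).  2026-09-05.
-/
import Literature.NumberTheory.Automorphic.ConjugateSymplecticLocalComponentSurjective   -- ★ `IdeleClassGroup.exists_isConjugateSymplectic_semilocalComponent_eq` (+ ★ `semilocalComponent`, `toHeckeCharacter`, `isOscillatorChar_toHeckeCharacter_iff`)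
import Literature.NumberTheory.Rogawski1990.SemilocalQuadraticCharExtension                -- ★ `isQuadraticCharExtension_semilocalComponent_of_baseChange_eq`
import HarnessLib

/-!
# R90 · S3 · (U3) brick (T1) «χ-pre» — transporting the `ω`-type local character `μ_v` along the (U3-F) ring datum `Φ`, and (U3-χ) MINUS ⟪U⟫ by ★ surjectivity

R90-TF section S3 (dealer R90-C12-plan (g2), DEAL (U3) 2026-09-04T23:34:52Z; census `R90/S3/CENSUS-U3-globalise.K2E3-p17-g10.md` 44140fde8ab714f6 §3 (T1)); seat K2E3-p17 (g10);
crux H413 = `stmt-HodgeConjecture-24833` (lane `--kind proof --supports … --as helper`).  THEOREMS ONLY (no `def`, no instance, no notation, no named fact, no `sorry`); ★ imports only.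

THE OBJECTS.  G's socket (U3-χ) `stub_R90_S3_auxGlobaliseChar` (`Cruxes/H413/Lines/R90_S3_LocalTransportWaveG.lean` :669) receives from (U3-F) a bi-continuous ring isomorphism
`Φ : L ⊗_{L⁺} L⁺_v ≃+* L′ ⊗_{L′⁺} L′⁺_{v′}` (`UnitaryGroup.LocalRing`) intertwining the conjugations (`hΦσ`), and from A1 a Hecke character `μ` of `L` with `μ|_{𝔸_{L⁺}^×} = ω_{L∕L⁺}`
(`hμω`); it must produce a unitary `μ′` of `L′` extending `ω_{L′∕L′⁺}` with `μ′_{v′} ∘ Φ = μ_v` and unramified off `v′` (⟪U⟫-χ).  Both roads of the census (Weil's extension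
principle ★ `exists_extension_of_character`; ★ surjectivity `exists_isConjugateSymplectic_semilocalComponent_eq`) start from the SAME local datum
`μ′_loc := μ_v ∘ Φ⁻¹ : (L′ ⊗ L′⁺_{v′})ˣ → ℂˣ` and need two facts about it, proved here:
* §1 (generic) `IsQuadraticCharExtension` («`= 1` on a `σ`-fixed unit iff it is `σ(y)·y`») is TRANSPORTED along any ring isomorphism semiconjugating `σ` to `τ`
  (`isQuadraticCharExtension_comp_unitsMap_of_semiconj`): fixed points and norms `σ(y)y` correspond under `Φ`;
* §2 (CM) hence `μ′_loc` is of `ω′`-type (★ `isQuadraticCharExtension_semilocalComponent_of_baseChange_eq` turns `hμω` into the `ω`-type of `μ_v`), is continuous (`hc′`, ★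
  `continuous_semilocalComponent`, `Continuous.units_map`), and `μ′_loc ∘ Φ = μ_v` (`auxGlobaliseChar_local_apply_unitsMap` — the shape of G's `hΦμ` :680–:681);
* §3 REACH EVIDENCE — (U3-χ) MINUS ⟪U⟫-χ in one stroke: ★ `exists_isConjugateSymplectic_semilocalComponent_eq` at `(L′, v′, μ′_loc)` gives a conjugate-symplectic `ψ` with
  `(toHeckeCharacter L′ ψ)_{v′} = μ′_loc`; `toHeckeCharacter` is unitary (★ `isUnitary_toHeckeCharacter`) and extends `ω′` (★ `isOscillatorChar_toHeckeCharacter_iff`): three of the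
  four conjuncts of (U3-χ) — `IsUnitary ∧ hμ′ω ∧ hΦμ` — with the socket's binders `hc′ hΦσ hv′ μ hμω` (`auxGlobaliseChar_of_unrFree`).  ⟪U⟫-χ is NOT claimed (the socket is never
  weakened; its payer takes the Weil road, census §1 χ-key).
[Rogawski1990, §4.8 p. 51 («`μ|C_F = ω_{E/F}`»); §13.8 p. 212, p. 216] [Liu2021, Def. 4.1] [ClozelHarrisTaylor2008, Lem. 4.1.1]

HONEST LABEL: helper lemmas + a ⟪U⟫-free sibling; (U3-χ) stays OPEN (its ⟪U⟫ clause is the content); HC_CM is proved only modulo the 7 printed citations (2 remaining named inputs: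
hLiu418 = stmt-HodgeConjecture-24832, h413 = stmt-HodgeConjecture-24833) until rung 0 closes; count-neutral.
-/

set_option autoImplicit false
-- the mandated namespace repeats the single-problem summit's segment (`HodgeConjecture.HodgeConjecture`)
set_option linter.dupNamespace false

noncomputable section

namespace Summit.HodgeConjecture.HodgeConjecture.R90.S3

open IsDedekindDomain NumberField Topology
open Literature.NumberTheory Literature.NumberTheory.Automorphic Literature.NumberTheory.Automorphic.UnitaryGroup
open Literature.NumberTheory.Rogawski1990 Literature.NumberTheory.GaloisRepresentations
open Literature.NumberTheory.Automorphic.IdeleClassGroup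
open Literature.RepresentationTheory.Liu2021 (isOscillatorChar_toHeckeCharacter_iff)

/-! ## §1 Transport of `IsQuadraticCharExtension` along a semiconjugating ring isomorphism -/

/-- **`ω`-type is transported along a ring isomorphism semiconjugating the involutions**: if `Φ ∘ σ = τ ∘ Φ` and `ν` is `= 1` exactly on the `σ`-norms among the
`σ`-fixed units, then `ν ∘ Φ⁻¹` is `= 1` exactly on the `τ`-norms among the `τ`-fixed units. [cite: Rogawski1990, §4.8 p. 51] -/
theorem isQuadraticCharExtension_comp_unitsMap_of_semiconj {R S : Type*} [CommRing R] [CommRing S] (Φ : R ≃+* S) {σ : R →+* R} {τ : S →+* S}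
    (hΦ : ∀ x, Φ (σ x) = τ (Φ x)) (ν : Rˣ →* ℂˣ) (hν : IsQuadraticCharExtension σ ν) :
    IsQuadraticCharExtension τ (ν.comp (Units.map (Φ.symm : S →+* R).toMonoidHom)) := by
  -- `Φ⁻¹` semiconjugates `τ` to `σ`
  have hΦ' : ∀ y, Φ.symm (τ y) = σ (Φ.symm y) := fun y =>
    Φ.injective (by rw [RingEquiv.apply_symm_apply, hΦ, RingEquiv.apply_symm_apply])
  have key : ∀ y : Sˣ, ((Units.map (Φ.symm : S →+* R).toMonoidHom y : Rˣ) : R) = Φ.symm (y : S) := fun _ => rfl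
  have keyΦ : ∀ y : Rˣ, ((Units.map (Φ : R →+* S).toMonoidHom y : Sˣ) : S) = Φ (y : R) := fun _ => rfl
  intro x' hx'
  have hx : σ ((Units.map (Φ.symm : S →+* R).toMonoidHom x' : Rˣ) : R) = (Units.map (Φ.symm : S →+* R).toMonoidHom x' : Rˣ) := by
    rw [key, ← hΦ', hx']
  rw [MonoidHom.comp_apply, hν _ hx]
  constructor
  · rintro ⟨y, hy⟩
    refine ⟨Units.map (Φ : R →+* S).toMonoidHom y, ?_⟩
    rw [key] at hy
    rw [keyΦ, ← hΦ, ← map_mul, hy, RingEquiv.apply_symm_apply]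
  · rintro ⟨y', hy'⟩
    refine ⟨Units.map (Φ.symm : S →+* R).toMonoidHom y', ?_⟩
    rw [key, key, ← hΦ', ← map_mul, hy']

/-! ## §2 The transported local datum `μ′_loc := μ_v ∘ Φ⁻¹` -/

variable (L : Type) [Field L] [NumberField L] [IsCMField L] (v : HeightOneSpectrum (𝓞 ↥(maximalRealSubfield L)))
  (L' : Type) [Field L'] [NumberField L'] [IsCMField L'] (v' : HeightOneSpectrum (𝓞 ↥(maximalRealSubfield L')))

/-- **`μ′_loc = μ_v ∘ Φ⁻¹` is of `ω′`-type** (G's `hΦσ` + `hμω`). [cite: Rogawski1990, §4.8 p. 51; §13.8 p. 216] -/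
theorem auxGlobaliseChar_local_isQuadraticCharExtension
    (Φ : UnitaryGroup.LocalRing L v ≃+* UnitaryGroup.LocalRing L' v')
    (hΦσ : ∀ x, Φ ((conjLocal L (IsCMField.complexConj L) v) x) = (conjLocal L' (IsCMField.complexConj L') v') (Φ x))
    (μ : HeckeCharacter L)
    (hμω : ∀ x : Literature.NumberTheory.GaloisRepresentations.ideleGroup ↥(maximalRealSubfield L),
      μ (AdeleRing.ideleBaseChange (↥(maximalRealSubfield L)) L x) = quadraticHeckeCharCM L x) :
    IsQuadraticCharExtension (conjLocal L' (IsCMField.complexConj L') v')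
      ((μ.semilocalComponent L v).comp (Units.map (Φ.symm : UnitaryGroup.LocalRing L' v' →+* UnitaryGroup.LocalRing L v).toMonoidHom)) :=
  isQuadraticCharExtension_comp_unitsMap_of_semiconj Φ hΦσ _ (isQuadraticCharExtension_semilocalComponent_of_baseChange_eq μ hμω v)

omit [IsCMField L] [IsCMField L'] in
/-- **`μ′_loc` is continuous** (G's `hc′` + ★ `continuous_semilocalComponent`). [cite: TateThesis1967, §4.3] -/
theorem auxGlobaliseChar_local_continuous
    (Φ : UnitaryGroup.LocalRing L v ≃+* UnitaryGroup.LocalRing L' v') (hc' : Continuous Φ.symm) (μ : HeckeCharacter L) :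
    Continuous fun x => ((((μ.semilocalComponent L v).comp (Units.map (Φ.symm : UnitaryGroup.LocalRing L' v' →+* UnitaryGroup.LocalRing L v).toMonoidHom)) x : ℂˣ) : ℂ) :=
  Units.continuous_val.comp ((UnitaryGroup.continuous_semilocalComponent L μ).comp
    (Continuous.units_map (Φ.symm : UnitaryGroup.LocalRing L' v' →+* UnitaryGroup.LocalRing L v).toMonoidHom hc'))

omit [IsCMField L] [IsCMField L'] in
/-- **`μ′_loc ∘ Φ = μ_v`** — the shape of G's `hΦμ` (:680–:681). [cite: Rogawski1990, §13.8 p. 212] -/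
theorem auxGlobaliseChar_local_apply_unitsMap
    (Φ : UnitaryGroup.LocalRing L v ≃+* UnitaryGroup.LocalRing L' v') (μ : HeckeCharacter L) (u : (UnitaryGroup.LocalRing L v)ˣ) :
    ((μ.semilocalComponent L v).comp (Units.map (Φ.symm : UnitaryGroup.LocalRing L' v' →+* UnitaryGroup.LocalRing L v).toMonoidHom))
        (Units.map (Φ : UnitaryGroup.LocalRing L v →+* UnitaryGroup.LocalRing L' v').toMonoidHom u) = μ.semilocalComponent L v u := by
  rw [MonoidHom.comp_apply]
  congr 1
  exact Units.ext (Φ.symm_apply_apply (u : UnitaryGroup.LocalRing L v))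

/-! ## §3 (U3-χ) minus ⟪U⟫-χ, by ★ surjectivity of conjugate-symplectic local components -/

/-- **(U3-χ) WITHOUT its unramified clause** — reach evidence, not the socket: given the (U3-F) ring datum (`hc′`, `hΦσ`, `hv′`) and `μ` with `μ|_{𝔸_{L⁺}^×} = ω` (`hμω`), a
UNITARY Hecke character `μ′` of `L′` with `μ′|_{𝔸_{L′⁺}^×} = ω′` and `μ′_{v′} ∘ Φ = μ_v` exists (★ `exists_isConjugateSymplectic_semilocalComponent_eq` at `μ_v ∘ Φ⁻¹`; CHT Lem.
4.1.1 inside).  The binders `hc`, `hur′`, `hμu` of the socket are not needed here. [cite: Rogawski1990, §13.8 p. 212, p. 216] [cite: Liu2021, Def. 4.1] [cite: ClozelHarrisTaylor2008, Lemma 4.1.1 (p. 116)] -/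
theorem auxGlobaliseChar_of_unrFree
    (Φ : UnitaryGroup.LocalRing L v ≃+* UnitaryGroup.LocalRing L' v') (hc' : Continuous Φ.symm)
    (hΦσ : ∀ x, Φ ((conjLocal L (IsCMField.complexConj L) v) x) = (conjLocal L' (IsCMField.complexConj L') v') (Φ x))
    (hv' : ∀ w' : UnitaryGroup.PlacesOver L' v', IsCMField.complexConj L' • w'.1 = w'.1)
    (μ : HeckeCharacter L)
    (hμω : ∀ x : Literature.NumberTheory.GaloisRepresentations.ideleGroup ↥(maximalRealSubfield L),
      μ (AdeleRing.ideleBaseChange (↥(maximalRealSubfield L)) L x) = quadraticHeckeCharCM L x) :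
    ∃ μ' : HeckeCharacter L',
      μ'.IsUnitary ∧
      (∀ x : Literature.NumberTheory.GaloisRepresentations.ideleGroup ↥(maximalRealSubfield L'),
        μ' (AdeleRing.ideleBaseChange (↥(maximalRealSubfield L')) L' x) = quadraticHeckeCharCM L' x) ∧
      (∀ u : (UnitaryGroup.LocalRing L v)ˣ,
        μ'.semilocalComponent L' v' (Units.map (Φ : UnitaryGroup.LocalRing L v →+* UnitaryGroup.LocalRing L' v').toMonoidHom u) = μ.semilocalComponent L v u) := by
  obtain ⟨ψ, hψ, hcomp⟩ := exists_isConjugateSymplectic_semilocalComponent_eq L' v' hv' _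
    (auxGlobaliseChar_local_isQuadraticCharExtension L v L' v' Φ hΦσ μ hμω) (auxGlobaliseChar_local_continuous L v L' v' Φ hc' μ)
  refine ⟨toHeckeCharacter L' ψ, isUnitary_toHeckeCharacter L' ψ, fun x => ?_, fun u => ?_⟩
  · have h := (isOscillatorChar_toHeckeCharacter_iff ψ).2 hψ x
    rw [pow_one] at h
    exact h
  · rw [hcomp]
    exact auxGlobaliseChar_local_apply_unitsMap L v L' v' Φ μ u

end Summit.HodgeConjecture.HodgeConjecture.R90.S3

end
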